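import Mathlib
import Summits.NavierStokesRegularity.NavierStokesRegularity.Theorems.EulerZoomLiouvillePowerGaugeEulerLiouvilleHoopSliceFrame
import Summits.NavierStokesRegularity.NavierStokesRegularity.Theorems.EulerZoomLiouvillePowerGaugeEulerLiouvilleHoopLateralModes

/-!
# LEL-2: THE LATERAL TERM OF ONE SLICE IS PAID BY THE θ̂-COLUMN, THE rr-ENTRY AND THE SINUOUS ENERGY (LEAD 19832 g15; nsreg-p2 ROUND-50 t53-LEL 2/3)

Helper for crux `EulerZoomLiouville.PowerGaugeEulerLiouville` (stmt-NavierStokesRegularity-19832), LEAD ns-typeII-p2 g15,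
`--supports stmt-NavierStokesRegularity-19832 --as helper`.  Chart-free, in the FRAME variables of ns-ezl-w2 g5's `hoop_slice_le_frame`
(`a t θ = V_r`, `b t θ = V_θ` on the circle of radius `t` of one slice, `∂_θ a = t·mr + b`, `∂_θ b = t·mθ − a`, `∂_t a = ad`; on the axis
`a 0 θ = v₀ cos θ + v₁ sin θ`):

* `integral_mul_sub_firstMode` — bilinear Pythagoras `∫(f − P₁f)(g − P₁g) = ∫fg − π⁻¹(C_f C_g + S_f S_g)`;
* **`lateral_slice_le_frame`** — `∫_θ a(T,θ)² ≤ E_a(T) + ∫₀^T t∫_θ(mr² + mθ²) + ∫₀^T t∫_θ ad²`,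
  `E_a(T) = π⁻¹((∫a T cos)² + (∫a T sin)²)` = the sinuous (first-mode) energy at the wall — EXACTLY the term that `hoop_slice_le_frame`
  carries with a minus sign (and that the hoop inequality drops), so that adding the two slice inequalities cancels it (nsreg-p2 R50 §1:
  «the wall comes for free»).
  Proof: `F(t) = ∫_θ a(t)² − E_a(t) = ∫_θ p(t)²` (`p = a − P₁a`) has `F(0) = 0` (the axis trace is a first mode) and
  `F′(t) = 2∫_θ p·∂_t p ≤ t⁻¹∫_θ p² + t∫_θ (∂_t p)² ≤ t∫_θ(mr² + mθ²) + t∫_θ ad²` by LEL-1 `lateral_modes_le` (`∫p² ≤ ∫[(∂_θa − b)² + (∂_θb + a)²]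
  = t²∫(mr² + mθ²)`) and Bessel (`∫(∂_t p)² = ∫ad² − E_{ad} ≤ ∫ad²`).

HONEST FRAMING: 1-D/2-D calculus; it proves nothing about the crux E (19832 OPEN), the lateral hoop inequality as a whole, or
Navier–Stokes regularity. [folklore; nsreg-p2 ROUND-50 §1; ns-idea-11 HOOP-NOTE §10(a)]
-/

noncomputable section

open Set Filter Topology Metric Function MeasureTheory Real
open scoped Interval

set_option linter.dupNamespace false

namespace Summit.NavierStokesRegularity.NavierStokesRegularity.Theorems.PowerGaugeEulerLiouville.HoopCore

/-- **Bilinear Pythagoras for the first-mode projection**: for continuous `f, g` on `[0, 2π]`,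
`∫ (f − P₁f)(g − P₁g) = ∫ f g − π⁻¹((∫f cos)(∫g cos) + (∫f sin)(∫g sin))`. [folklore] -/
theorem integral_mul_sub_firstMode {f g : ℝ → ℝ} (hf : Continuous f) (hg : Continuous g) :
    ∫ x in (0 : ℝ)..2 * π,
        (f x - (π⁻¹ * (∫ y in (0 : ℝ)..2 * π, f y * Real.cos y) * Real.cos x +
          π⁻¹ * (∫ y in (0 : ℝ)..2 * π, f y * Real.sin y) * Real.sin x)) *
        (g x - (π⁻¹ * (∫ y in (0 : ℝ)..2 * π, g y * Real.cos y) * Real.cos x +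
          π⁻¹ * (∫ y in (0 : ℝ)..2 * π, g y * Real.sin y) * Real.sin x)) =
      (∫ x in (0 : ℝ)..2 * π, f x * g x) -
        π⁻¹ * ((∫ y in (0 : ℝ)..2 * π, f y * Real.cos y) * (∫ y in (0 : ℝ)..2 * π, g y * Real.cos y) +
          (∫ y in (0 : ℝ)..2 * π, f y * Real.sin y) * (∫ y in (0 : ℝ)..2 * π, g y * Real.sin y)) := by
  have hπ : (π : ℝ) ≠ 0 := Real.pi_ne_zero
  set Cf := ∫ y in (0 : ℝ)..2 * π, f y * Real.cos y with hCf
  set Sf := ∫ y in (0 : ℝ)..2 * π, f y * Real.sin y with hSf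
  set Cg := ∫ y in (0 : ℝ)..2 * π, g y * Real.cos y with hCg
  set Sg := ∫ y in (0 : ℝ)..2 * π, g y * Real.sin y with hSg
  set f₁ : ℝ → ℝ := fun x => π⁻¹ * Cf * Real.cos x + π⁻¹ * Sf * Real.sin x with hf₁
  set g₁ : ℝ → ℝ := fun x => π⁻¹ * Cg * Real.cos x + π⁻¹ * Sg * Real.sin x with hg₁
  have hf₁c : Continuous f₁ := by rw [hf₁]; fun_prop
  have hg₁c : Continuous g₁ := by rw [hg₁]; fun_prop
  have e1 : ∫ x in (0 : ℝ)..2 * π, f₁ x * g x = π⁻¹ * Cf * Cg + π⁻¹ * Sf * Sg := by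
    rw [hf₁, integral_firstMode_mul hg]
  have e2 : ∫ x in (0 : ℝ)..2 * π, g₁ x * f x = π⁻¹ * Cg * Cf + π⁻¹ * Sg * Sf := by
    rw [hg₁, integral_firstMode_mul hf]
  have e3 : ∫ x in (0 : ℝ)..2 * π, f₁ x * g₁ x = π * (π⁻¹ * Cf * (π⁻¹ * Cg) + π⁻¹ * Sf * (π⁻¹ * Sg)) := by
    rw [hf₁, hg₁, integral_firstMode_mul_firstMode]
  have e : (fun x => (f x - f₁ x) * (g x - g₁ x)) = fun x => f x * g x - f₁ x * g x - g₁ x * f x + f₁ x * g₁ x :=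
    funext fun x => by ring
  have key : ∫ x in (0 : ℝ)..2 * π, (f x - f₁ x) * (g x - g₁ x) =
      (∫ x in (0 : ℝ)..2 * π, f x * g x) - (∫ x in (0 : ℝ)..2 * π, f₁ x * g x) -
        (∫ x in (0 : ℝ)..2 * π, g₁ x * f x) + ∫ x in (0 : ℝ)..2 * π, f₁ x * g₁ x := by
    rw [e, intervalIntegral.integral_add, intervalIntegral.integral_sub, intervalIntegral.integral_sub]
    · exact (hf.mul hg).intervalIntegrable _ _
    · exact (hf₁c.mul hg).intervalIntegrable _ _
    · exact ((hf.mul hg).sub (hf₁c.mul hg)).intervalIntegrable _ _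
    · exact (hg₁c.mul hf).intervalIntegrable _ _
    · exact (((hf.mul hg).sub (hf₁c.mul hg)).sub (hg₁c.mul hf)).intervalIntegrable _ _
    · exact (hf₁c.mul hg₁c).intervalIntegrable _ _
  have key' : ∫ x in (0 : ℝ)..2 * π, (f x - f₁ x) * (g x - g₁ x) =
      (∫ x in (0 : ℝ)..2 * π, f x * g x) - π⁻¹ * (Cf * Cg + Sf * Sg) := by
    rw [key, e1, e2, e3]; field_simp; ring
  simpa only [hf₁, hg₁] using key'

/-- **LEL-2 — THE LATERAL TERM OF ONE SLICE** (frame form).  Data as in `hoop_slice_le_frame` (without `β` and the divergence relation,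
which the lateral term does not need) plus the first-mode axis trace `a 0 θ = v₀ cos θ + v₁ sin θ`.  Then
`∫_θ a(T,θ)² ≤ π⁻¹((∫a T cos)² + (∫a T sin)²) + ∫₀^T t∫_θ(mr² + mθ²) + ∫₀^T t∫_θ ad²`. [folklore; nsreg-p2 ROUND-50 §1] -/
theorem lateral_slice_le_frame {a b mr mθ ad : ℝ → ℝ → ℝ} {T v₀ v₁ : ℝ} (hT : 0 < T)
    (haθ : ∀ t θ, HasDerivAt (fun θ => a t θ) (t * mr t θ + b t θ) θ)
    (hbθ : ∀ t θ, HasDerivAt (fun θ => b t θ) (t * mθ t θ - a t θ) θ)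
    (had : ∀ t θ, HasDerivAt (fun t => a t θ) (ad t θ) t)
    (hac : Continuous (uncurry a)) (hbc : Continuous (uncurry b)) (hmrc : Continuous (uncurry mr))
    (hmθc : Continuous (uncurry mθ)) (hadc : Continuous (uncurry ad))
    (haper : ∀ t, a t (2 * π) = a t 0) (hbper : ∀ t, b t (2 * π) = b t 0)
    (ha0 : ∀ θ, a 0 θ = v₀ * Real.cos θ + v₁ * Real.sin θ) :
    ∫ θ in (0 : ℝ)..2 * π, a T θ ^ 2 ≤
      π⁻¹ * ((∫ y in (0 : ℝ)..2 * π, a T y * Real.cos y) ^ 2 + (∫ y in (0 : ℝ)..2 * π, a T y * Real.sin y) ^ 2)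
        + (∫ t in (0 : ℝ)..T, t * ∫ θ in (0 : ℝ)..2 * π, (mr t θ ^ 2 + mθ t θ ^ 2))
        + ∫ t in (0 : ℝ)..T, t * ∫ θ in (0 : ℝ)..2 * π, ad t θ ^ 2 := by
  have hπ : (π : ℝ) ≠ 0 := Real.pi_ne_zero
  have hπ0 : 0 < π := Real.pi_pos
  -- sections at fixed `t` are continuous
  have hsec : ∀ {f : ℝ → ℝ → ℝ}, Continuous (uncurry f) → ∀ t, Continuous (f t) :=
    fun hf t => hf.comp (continuous_const.prodMk continuous_id)
  have hac' : Continuous fun p : ℝ × ℝ => a p.1 p.2 := hac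
  have hadc' : Continuous fun p : ℝ × ℝ => ad p.1 p.2 := hadc
  have hmrc' : Continuous fun p : ℝ × ℝ => mr p.1 p.2 := hmrc
  have hmθc' : Continuous fun p : ℝ × ℝ => mθ p.1 p.2 := hmθc
  -- coefficient functions `C, S` of `a` and `C', S'` of `ad`
  set C : ℝ → ℝ := fun t => ∫ y in (0 : ℝ)..2 * π, a t y * Real.cos y with hCdef
  set S : ℝ → ℝ := fun t => ∫ y in (0 : ℝ)..2 * π, a t y * Real.sin y with hSdef
  set C' : ℝ → ℝ := fun t => ∫ y in (0 : ℝ)..2 * π, ad t y * Real.cos y with hC'def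
  set S' : ℝ → ℝ := fun t => ∫ y in (0 : ℝ)..2 * π, ad t y * Real.sin y with hS'def
  have hC : ∀ t, HasDerivAt C (C' t) t := fun t => hasDerivAt_intervalIntegral_mul_weight had hac hadc continuous_cos t
  have hS : ∀ t, HasDerivAt S (S' t) t := fun t => hasDerivAt_intervalIntegral_mul_weight had hac hadc continuous_sin t
  have hCc : Continuous C := continuous_iff_continuousAt.2 fun t => (hC t).continuousAt
  have hSc : Continuous S := continuous_iff_continuousAt.2 fun t => (hS t).continuousAt
  have hC'c : Continuous C' :=
    intervalIntegral.continuous_parametric_intervalIntegral_of_continuous' (f := fun t y => ad t y * Real.cos y)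
      (hadc'.mul (continuous_cos.comp continuous_snd)) _ _
  have hS'c : Continuous S' :=
    intervalIntegral.continuous_parametric_intervalIntegral_of_continuous' (f := fun t y => ad t y * Real.sin y)
      (hadc'.mul (continuous_sin.comp continuous_snd)) _ _
  -- `G(t) = ∫_θ a(t)²` and its derivative
  set G : ℝ → ℝ := fun t => ∫ θ in (0 : ℝ)..2 * π, a t θ ^ 2 with hGdef
  have hG : ∀ t, HasDerivAt G (∫ θ in (0 : ℝ)..2 * π, 2 * a t θ * ad t θ) t := fun t =>
    hasDerivAt_intervalIntegral_of_continuous (F := fun t θ => a t θ ^ 2) (F' := fun t θ => 2 * a t θ * ad t θ)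
      (fun t θ => ((had t θ).fun_pow 2).congr_deriv (by norm_num))
      (by show Continuous fun p : ℝ × ℝ => a p.1 p.2 ^ 2; fun_prop)
      (by show Continuous fun p : ℝ × ℝ => 2 * a p.1 p.2 * ad p.1 p.2; fun_prop) _ _ t
  have hG'c : Continuous fun t => ∫ θ in (0 : ℝ)..2 * π, 2 * a t θ * ad t θ :=
    intervalIntegral.continuous_parametric_intervalIntegral_of_continuous' (f := fun t θ => 2 * a t θ * ad t θ)
      (by show Continuous fun p : ℝ × ℝ => 2 * a p.1 p.2 * ad p.1 p.2; fun_prop) _ _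
  -- `F = G − E`, `E = π⁻¹(C² + S²)`
  set F : ℝ → ℝ := fun t => G t - π⁻¹ * (C t ^ 2 + S t ^ 2) with hFdef
  set F' : ℝ → ℝ := fun t => (∫ θ in (0 : ℝ)..2 * π, 2 * a t θ * ad t θ) - π⁻¹ * (2 * C t * C' t + 2 * S t * S' t)
    with hF'def
  have hF : ∀ t, HasDerivAt F (F' t) t := by
    intro t
    have h := (hG t).sub ((((hC t).pow 2).add ((hS t).pow 2)).const_mul π⁻¹)
    refine h.congr_deriv ?_
    simp only [hF'def, Nat.cast_ofNat]
    ring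
  have hF'c : Continuous F' := by
    rw [hF'def]
    exact hG'c.sub (continuous_const.mul (((continuous_const.mul hCc).mul hC'c).add ((continuous_const.mul hSc).mul hS'c)))
  -- `F(0) = 0`: the axis trace is a first mode
  have hF0 : F 0 = 0 := by
    have hG0 : G 0 = π * (v₀ ^ 2 + v₁ ^ 2) := by
      simp only [hGdef]
      rw [intervalIntegral.integral_congr (fun θ _ => by rw [ha0 θ])]
      exact integral_firstMode_sq v₀ v₁
    have hE0 : π⁻¹ * (C 0 ^ 2 + S 0 ^ 2) = π * (v₀ ^ 2 + v₁ ^ 2) := by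
      have h := firstMode_energy_of_firstMode v₀ v₁
      have hC0 : C 0 = ∫ y in (0 : ℝ)..2 * π, (v₀ * Real.cos y + v₁ * Real.sin y) * Real.cos y := by
        simp only [hCdef]; exact intervalIntegral.integral_congr fun y _ => by rw [ha0 y]
      have hS0 : S 0 = ∫ y in (0 : ℝ)..2 * π, (v₀ * Real.cos y + v₁ * Real.sin y) * Real.sin y := by
        simp only [hSdef]; exact intervalIntegral.integral_congr fun y _ => by rw [ha0 y]
      rw [hC0, hS0, h]
    simp only [hFdef]
    rw [hG0, hE0, sub_self]
  -- the pointwise bound on `F'`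
  have hpt : ∀ t, 0 ≤ t → F' t ≤ t * (∫ θ in (0 : ℝ)..2 * π, (mr t θ ^ 2 + mθ t θ ^ 2)) +
      t * ∫ θ in (0 : ℝ)..2 * π, ad t θ ^ 2 := by
    intro t ht
    have hat : Continuous (a t) := hsec hac t
    have hadt : Continuous (ad t) := hsec hadc t
    have hbt : Continuous (b t) := hsec hbc t
    -- the rests `p = a − P₁a`, `pd = ad − P₁ad` at this `t`
    set p : ℝ → ℝ := fun θ => a t θ - (π⁻¹ * C t * Real.cos θ + π⁻¹ * S t * Real.sin θ) with hpdef
    set pd : ℝ → ℝ := fun θ => ad t θ - (π⁻¹ * C' t * Real.cos θ + π⁻¹ * S' t * Real.sin θ) with hpddef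
    have hpc : Continuous p := by rw [hpdef]; fun_prop
    have hpdc : Continuous pd := by rw [hpddef]; fun_prop
    -- (A) `F' t = 2 ∫ p·pd`
    have hA : F' t = 2 * ∫ θ in (0 : ℝ)..2 * π, p θ * pd θ := by
      have h := integral_mul_sub_firstMode hat hadt
      have h2 : ∫ θ in (0 : ℝ)..2 * π, 2 * a t θ * ad t θ = 2 * ∫ θ in (0 : ℝ)..2 * π, a t θ * ad t θ := by
        rw [← intervalIntegral.integral_const_mul]
        exact intervalIntegral.integral_congr fun θ _ => by ring
      simp only [hF'def, hpdef, hpddef]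
      rw [h2, h]
      ring
    -- (B) `2 t ∫ p pd ≤ ∫ p² + t² ∫ pd²`
    have hB : 2 * t * (∫ θ in (0 : ℝ)..2 * π, p θ * pd θ) ≤
        (∫ θ in (0 : ℝ)..2 * π, p θ ^ 2) + t ^ 2 * ∫ θ in (0 : ℝ)..2 * π, pd θ ^ 2 := by
      have h0 : 0 ≤ ∫ θ in (0 : ℝ)..2 * π, (p θ - t * pd θ) ^ 2 :=
        intervalIntegral.integral_nonneg (by positivity) fun θ _ => sq_nonneg _
      have hexp : ∫ θ in (0 : ℝ)..2 * π, (p θ - t * pd θ) ^ 2 =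
          (∫ θ in (0 : ℝ)..2 * π, p θ ^ 2) - 2 * t * (∫ θ in (0 : ℝ)..2 * π, p θ * pd θ) +
            t ^ 2 * ∫ θ in (0 : ℝ)..2 * π, pd θ ^ 2 := by
        have e : (fun θ => (p θ - t * pd θ) ^ 2) = fun θ => p θ ^ 2 - 2 * t * (p θ * pd θ) + t ^ 2 * pd θ ^ 2 :=
          funext fun θ => by ring
        rw [e, intervalIntegral.integral_add, intervalIntegral.integral_sub, intervalIntegral.integral_const_mul,
          intervalIntegral.integral_const_mul]
        · exact (hpc.pow 2).intervalIntegrable _ _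
        · exact ((hpc.mul hpdc).const_mul _).intervalIntegrable _ _
        · exact ((hpc.pow 2).sub ((hpc.mul hpdc).const_mul _)).intervalIntegrable _ _
        · exact ((hpdc.pow 2).const_mul _).intervalIntegrable _ _
      linarith
    -- (C) LEL-1: `∫ p² ≤ t² ∫ (mr² + mθ²)`
    have hCin : (∫ θ in (0 : ℝ)..2 * π, p θ ^ 2) ≤ t ^ 2 * ∫ θ in (0 : ℝ)..2 * π, (mr t θ ^ 2 + mθ t θ ^ 2) := by
      have h := lateral_modes_le (a := a t) (b := b t) (a' := fun θ => t * mr t θ + b t θ)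
        (b' := fun θ => t * mθ t θ - a t θ) (haθ t) (by fun_prop) (haper t) (hbθ t) (by fun_prop) (hbper t)
      have hq : 0 ≤ ∫ x in (0 : ℝ)..2 * π,
          (b t x - (π⁻¹ * (∫ y in (0 : ℝ)..2 * π, b t y * Real.cos y) * Real.cos x +
            π⁻¹ * (∫ y in (0 : ℝ)..2 * π, b t y * Real.sin y) * Real.sin x)) ^ 2 :=
        intervalIntegral.integral_nonneg (by positivity) fun x _ => sq_nonneg _
      have hcol : ∫ x in (0 : ℝ)..2 * π, ((t * mr t x + b t x - b t x) ^ 2 + (t * mθ t x - a t x + a t x) ^ 2) =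
          t ^ 2 * ∫ θ in (0 : ℝ)..2 * π, (mr t θ ^ 2 + mθ t θ ^ 2) := by
        rw [← intervalIntegral.integral_const_mul]
        exact intervalIntegral.integral_congr fun θ _ => by ring
      have hp' : (∫ θ in (0 : ℝ)..2 * π, p θ ^ 2) = ∫ x in (0 : ℝ)..2 * π,
          (a t x - (π⁻¹ * (∫ y in (0 : ℝ)..2 * π, a t y * Real.cos y) * Real.cos x +
            π⁻¹ * (∫ y in (0 : ℝ)..2 * π, a t y * Real.sin y) * Real.sin x)) ^ 2 := by
        simp only [hpdef, hCdef, hSdef]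
      rw [hcol] at h
      linarith
    -- (D) Bessel: `∫ pd² ≤ ∫ ad²`
    have hD : (∫ θ in (0 : ℝ)..2 * π, pd θ ^ 2) ≤ ∫ θ in (0 : ℝ)..2 * π, ad t θ ^ 2 := by
      have h := integral_mul_sub_firstMode hadt hadt
      have hsq : (∫ θ in (0 : ℝ)..2 * π, pd θ ^ 2) = ∫ x in (0 : ℝ)..2 * π,
          (ad t x - (π⁻¹ * (∫ y in (0 : ℝ)..2 * π, ad t y * Real.cos y) * Real.cos x +
            π⁻¹ * (∫ y in (0 : ℝ)..2 * π, ad t y * Real.sin y) * Real.sin x)) *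
          (ad t x - (π⁻¹ * (∫ y in (0 : ℝ)..2 * π, ad t y * Real.cos y) * Real.cos x +
            π⁻¹ * (∫ y in (0 : ℝ)..2 * π, ad t y * Real.sin y) * Real.sin x)) := by
        simp only [hpddef, hC'def, hS'def]
        exact intervalIntegral.integral_congr fun θ _ => by ring
      have hsq2 : (∫ θ in (0 : ℝ)..2 * π, ad t θ ^ 2) = ∫ x in (0 : ℝ)..2 * π, ad t x * ad t x :=
        intervalIntegral.integral_congr fun θ _ => by ring
      rw [hsq, h, hsq2]
      have h0 : 0 ≤ π⁻¹ * ((∫ y in (0 : ℝ)..2 * π, ad t y * Real.cos y) * (∫ y in (0 : ℝ)..2 * π, ad t y * Real.cos y) +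
          (∫ y in (0 : ℝ)..2 * π, ad t y * Real.sin y) * (∫ y in (0 : ℝ)..2 * π, ad t y * Real.sin y)) := by
        have : 0 ≤ π⁻¹ := inv_nonneg.2 hπ0.le
        nlinarith [mul_self_nonneg (∫ y in (0 : ℝ)..2 * π, ad t y * Real.cos y),
          mul_self_nonneg (∫ y in (0 : ℝ)..2 * π, ad t y * Real.sin y)]
      linarith
    -- combine
    have hH0 : 0 ≤ ∫ θ in (0 : ℝ)..2 * π, (mr t θ ^ 2 + mθ t θ ^ 2) :=
      intervalIntegral.integral_nonneg (by positivity) fun θ _ => by positivity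
    have hA0 : 0 ≤ ∫ θ in (0 : ℝ)..2 * π, ad t θ ^ 2 :=
      intervalIntegral.integral_nonneg (by positivity) fun θ _ => sq_nonneg _
    rcases eq_or_lt_of_le ht with h0 | hpos
    · -- `t = 0`: `p = 0` on the axis, so `F' 0 = 0`
      subst h0
      have hp0 : ∀ θ, p θ = 0 := by
        intro θ
        have hC0 : C 0 = π * v₀ := by
          have h := integral_firstMode_mul_firstMode v₀ v₁ 1 0
          simp only [one_mul, zero_mul, add_zero, mul_one, mul_zero] at h
          simp only [hCdef]
          rw [intervalIntegral.integral_congr (fun y _ => by rw [ha0 y])]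
          exact h
        have hS0 : S 0 = π * v₁ := by
          have h := integral_firstMode_mul_firstMode v₀ v₁ 0 1
          simp only [one_mul, zero_mul, zero_add, mul_one, mul_zero] at h
          simp only [hSdef]
          rw [intervalIntegral.integral_congr (fun y _ => by rw [ha0 y])]
          exact h
        simp only [hpdef]
        rw [ha0 θ, hC0, hS0]
        field_simp
        ring
      rw [hA, intervalIntegral.integral_congr (fun θ _ => by rw [hp0 θ])]
      simp
    · have h1 : 2 * (∫ θ in (0 : ℝ)..2 * π, p θ * pd θ) ≤
          t⁻¹ * (∫ θ in (0 : ℝ)..2 * π, p θ ^ 2) + t * ∫ θ in (0 : ℝ)..2 * π, pd θ ^ 2 := by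
        have ht0 : t ≠ 0 := hpos.ne'
        have key : t * (2 * ∫ θ in (0 : ℝ)..2 * π, p θ * pd θ) ≤
            t * (t⁻¹ * (∫ θ in (0 : ℝ)..2 * π, p θ ^ 2) + t * ∫ θ in (0 : ℝ)..2 * π, pd θ ^ 2) := by
          have e1 : t * (2 * ∫ θ in (0 : ℝ)..2 * π, p θ * pd θ) = 2 * t * ∫ θ in (0 : ℝ)..2 * π, p θ * pd θ := by ring
          have e2 : t * (t⁻¹ * (∫ θ in (0 : ℝ)..2 * π, p θ ^ 2) + t * ∫ θ in (0 : ℝ)..2 * π, pd θ ^ 2) =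
              (∫ θ in (0 : ℝ)..2 * π, p θ ^ 2) + t ^ 2 * ∫ θ in (0 : ℝ)..2 * π, pd θ ^ 2 := by
            field_simp
          rw [e1, e2]; exact hB
        exact le_of_mul_le_mul_left key hpos
      have h2 : t⁻¹ * (∫ θ in (0 : ℝ)..2 * π, p θ ^ 2) ≤ t * ∫ θ in (0 : ℝ)..2 * π, (mr t θ ^ 2 + mθ t θ ^ 2) := by
        calc t⁻¹ * (∫ θ in (0 : ℝ)..2 * π, p θ ^ 2) ≤ t⁻¹ * (t ^ 2 * ∫ θ in (0 : ℝ)..2 * π, (mr t θ ^ 2 + mθ t θ ^ 2)) :=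
              mul_le_mul_of_nonneg_left hCin (inv_nonneg.2 ht)
          _ = t * ∫ θ in (0 : ℝ)..2 * π, (mr t θ ^ 2 + mθ t θ ^ 2) := by field_simp
      have h3 : t * (∫ θ in (0 : ℝ)..2 * π, pd θ ^ 2) ≤ t * ∫ θ in (0 : ℝ)..2 * π, ad t θ ^ 2 :=
        mul_le_mul_of_nonneg_left hD ht
      rw [hA]
      linarith
  -- integrate: `F T = ∫₀^T F' ≤ ∫₀^T (t·H + t·A)`
  have hHc : Continuous fun t => t * ∫ θ in (0 : ℝ)..2 * π, (mr t θ ^ 2 + mθ t θ ^ 2) :=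
    continuous_id.mul (intervalIntegral.continuous_parametric_intervalIntegral_of_continuous'
      (f := fun t θ => mr t θ ^ 2 + mθ t θ ^ 2) (by show Continuous fun p : ℝ × ℝ => mr p.1 p.2 ^ 2 + mθ p.1 p.2 ^ 2; fun_prop) _ _)
  have hAc : Continuous fun t => t * ∫ θ in (0 : ℝ)..2 * π, ad t θ ^ 2 :=
    continuous_id.mul (intervalIntegral.continuous_parametric_intervalIntegral_of_continuous'
      (f := fun t θ => ad t θ ^ 2) (by show Continuous fun p : ℝ × ℝ => ad p.1 p.2 ^ 2; fun_prop) _ _)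
  have hFTC : F T - F 0 = ∫ t in (0 : ℝ)..T, F' t :=
    (intervalIntegral.integral_eq_sub_of_hasDerivAt (fun t _ => hF t) (hF'c.intervalIntegrable _ _)).symm
  have hmono : ∫ t in (0 : ℝ)..T, F' t ≤ ∫ t in (0 : ℝ)..T,
      (t * (∫ θ in (0 : ℝ)..2 * π, (mr t θ ^ 2 + mθ t θ ^ 2)) + t * ∫ θ in (0 : ℝ)..2 * π, ad t θ ^ 2) :=
    intervalIntegral.integral_mono_on hT.le (hF'c.intervalIntegrable _ _) ((hHc.add hAc).intervalIntegrable _ _)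
      fun t ht => hpt t ht.1
  rw [intervalIntegral.integral_add (hHc.intervalIntegrable _ _) (hAc.intervalIntegrable _ _)] at hmono
  have hGT : ∫ θ in (0 : ℝ)..2 * π, a T θ ^ 2 = F T + π⁻¹ * (C T ^ 2 + S T ^ 2) := by
    simp only [hFdef, hGdef]; ring
  rw [hGT]
  simp only [hCdef, hSdef]
  linarith [hFTC, hF0, hmono]

end Summit.NavierStokesRegularity.NavierStokesRegularity.Theorems.PowerGaugeEulerLiouville.HoopCore

end
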